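import Summits.HodgeConjecture.HodgeConjecture.Theorems.Ring2WeilCoverageTypeNormSign
import Summits.HodgeConjecture.HodgeConjecture.Theorems.Ring2WeilCoverageTwistedUnitSignature
import Summits.HodgeConjecture.HodgeConjecture.Theorems.Ring2WeilCoverageCyclotomicTwistedLevel39
import Summits.HodgeConjecture.HodgeConjecture.Theorems.Ring2WeilCoverageCyclotomicTwistedLevel56
import HarnessLib

/-!
# Weil-type family coverage — THE RELATIVE NORM-SIGN LAW (engine): over ONE real place of a subfield `ℚ(s) ⊂ K⁺`, the
# twisted sign count of `ϖζ₀` differs from that of `ζ₀` by the sign of the RELATIVE norm `N_{K⁺/ℚ(s)}(ϖ₀)` at that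
# place (any CM field; the index-2 levels `39`, `56` of the census, where the verdict is a PAIR of twisted parities)

research route conditional on HC_CM; not a corollary; Q11.4-sentence-2 already refuted in dim ≥ 3.

Ring 2, WEIL-TYPE FAMILY-COVERAGE CENSUS (`HOME/WEIL-FAMILY-COVERAGE.md` `## b01`, blocks b01.25 (A), b01.39–40 (the index-2
levels `M = 39, 56`: `ℂ^Φ/Φ(ℤ[ζ_M])` is principally polarisable iff BOTH twisted counts `|S_Φ ∩ C₊ ∩ N_odd|`,
`|S_Φ ∩ C₋ ∩ N_odd|` are even, `C± =` the residues over the two real places of `ℚ(√13)` resp. `ℚ(√2)`), b01.42 (the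
norm-sign law); owner ring2-b01), part 58 of the `Ring2WeilCoverage*` series — the relative form of part 55
(`…TypeNormSign`).  Part 55 compared the types `𝔣₀` and `(ϖ₀)𝔣₀` through the FULL sign count on `Φ`, governed by the sign
of `N_{K⁺/ℚ}(ϖ₀)`; at the index-2 levels the criterion (part 33 `…TwistedUnitSignature`, parts 36–41) uses the counts
RESTRICTED to the embeddings `T = {ψ : ψ(s) = φ₀(s)}` above one real place of `ℚ(s) ⊂ K⁺`, and the governing quantity
becomes the sign of the relative norm `N_{K⁺/ℚ(s)}(ϖ₀)` AT THAT PLACE: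

* §1 `ncard_negSet_on_realMul_mod_two`: `#{φ ∈ Φ ∩ T : Im (ϖζ₀)^φ < 0} ≡ #{φ ∈ Φ ∩ T : Re ϖ^φ < 0} +
  #{φ ∈ Φ ∩ T : Im ζ₀^φ < 0} (mod 2)` (part 55's symmetric difference, restricted to `T`).
* §2 **`re_relNorm_pos_iff_even_ncard_on`**: `Re φ₀|_{K⁺}(N_{K⁺/ℚ(s)}(ϖ₀)) > 0 ⟺ #{φ ∈ Φ, φ(s) = φ₀(s) : Re ϖ^φ < 0}`
  even (part 33's `∏_{φ ∈ Φ, φ(s) = φ₀(s)} Re x^φ = Re φ₀|_{K⁺}(N_{K⁺/ℚ(s)}(x))`).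
* §3 (hypothesis-free) **`even_ncard_negSet_on_realMul_iff`**: `#{φ ∈ Φ ∩ T : Im (ϖζ₀)^φ < 0}` even ⟺
  (`#{φ ∈ Φ ∩ T : Im ζ₀^φ < 0}` even ⟺ `Re φ₀(N_{K⁺/ℚ(s)}(ϖ₀)) > 0`).
* §4 under the RELATIVE THEOREM L (i) of part 33 (`hN`: every unit `v` of `𝓞 K⁺` has `Re σ(N_{K⁺/ℚ(s)}(v)) > 0` at
  every `σ` — parts 32/34 at `39/56`): **`not_and_of_re_relNorm_neg`** — if `Re φ₀(N_{K⁺/ℚ(s)}(ϖ₀)) < 0` for some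
  `φ₀`, the types `𝔣₀` and `(ϖ₀)𝔣₀` do not BOTH occur on `ℂ^Φ/D(𝔪)` (one of the two `T`-counts is odd); and
  `not_exists_realMul_of_exists_of_re_relNorm_neg` / `not_exists_span_of_principal_of_re_relNorm_neg` (an occurring
  type `𝔣₀` resp. a principal polarisation forbids type `(ϖ₀)𝔣₀` resp. `(ϖ₀)`); `even_ncard_on_of_exists`.

* §5 `relNorm_units_pos_thirtyNine` / `relNorm_units_pos_fiftySix`: the relative THEOREM L (i) of parts 32/34b PACKAGED for the
  displayed `s = √13 = 1 + 2(ζ³ + ζ⁹ + ζ¹² + ζ²⁷ + ζ³⁰ + ζ³⁶) ∈ ℚ(ζ₃₉)⁺` and `s = √2 = ζ⁷ + ζ⁴⁹ ∈ ℚ(ζ₅₆)⁺` (with the auxiliary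
  `w`, `w² = 78 − 18s` resp. `w = √7`, built as in parts 36/37).

The EXISTENCE half at `39/56` needs the two-class unit supply of parts 39/40 (`exists_units_sign_eq_on`) and is left to
the level files; this file is the place-by-place bookkeeping only.  HONEST FRAMING: torus-level statements about
Shimura's divisors of type `(K; Φ; 𝔣₀)` [Sh98 §14.3 Prop. 5]; nothing here is a statement about Hodge classes, `W_K`,
general members or HC; `HC_CM` is used nowhere.  No `def`, no named fact, no `sorry`.

References: [cite: Shimura1998, §14.3 Prop. 4–5, pp. 103–104]; census b01.25 (A) / b01.39 (seat-derived).
-/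

noncomputable section

open scoped Classical nonZeroDivisors NumberField ComplexConjugate
open NumberField NumberField.ComplexEmbedding Module FractionalIdeal Complex Polynomial Finset IntermediateField

namespace Summit.HodgeConjecture.Ring2WeilCoverage.TypeRelativeNormSign

open Literature.AlgebraicGeometry.Motives (CMType)
open Literature.NumberTheory.ComplexMultiplication
open Literature.NumberTheory.ComplexMultiplication.CMTypeLattice
open Summit.HodgeConjecture.Ring2WeilCoverage.CMTypeSignParity
open Summit.HodgeConjecture.Ring2WeilCoverage.CMUnitSignature
open Summit.HodgeConjecture.Ring2WeilCoverage.TypeNormSign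
open Summit.HodgeConjecture.Ring2WeilCoverage.TwistedUnitSignature
open Summit.HodgeConjecture.Ring2WeilCoverage.RelativeNormPositivityLevels
open Summit.HodgeConjecture.Ring2WeilCoverage.CyclotomicTwistedLevel39 (sq_gaussThirteen complexConj_gaussThirteen
  two_mul_sq_piDiff complexConj_piDiff)
open Summit.HodgeConjecture.Ring2WeilCoverage.CyclotomicTwistedLevel56 (sq_sqrtTwo complexConj_sqrtTwo)
open Summit.HodgeConjecture.Ring2WeilCoverage.CyclotomicUnconditional (sq_sqrtSeven complexConj_sqrtSeven)
open Summit.HodgeConjecture.Ring2WeilCoverage.CyclotomicUnconditionalSqrtFive (sq_gaussThree complexConj_gaussThree)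

variable {K : Type} [Field K] [NumberField K] [IsCMField K] (Φ : CMType K)
  (𝔪 : (FractionalIdeal (𝓞 K)⁰ K)ˣ) {ζ₀ : K} {𝔣₀ : Ideal (𝓞 (maximalRealSubfield K))}

/-- the image in `K` of an integer `ϖ₀` of the maximal real subfield. -/
local notation3 (prettyPrint := false) "𝓇 " x:max => (algebraMap (𝓞 (maximalRealSubfield K)) K x)

/-- `Re φ₀|_{K⁺}(N_{K⁺/ℚ(s)}(x))` — the relative norm of `x ∈ K⁺` to `ℚ(s)` read at the place under `φ₀`. -/
local notation3 (prettyPrint := false) "RN[" φ₀ "," s "] " x:max =>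
  (((RingHom.comp (φ₀ : K →+* ℂ) (algebraMap (maximalRealSubfield K) K))
    (algebraMap (ℚ⟮(s : maximalRealSubfield K)⟯) (maximalRealSubfield K)
      (Algebra.norm (ℚ⟮(s : maximalRealSubfield K)⟯) (x : maximalRealSubfield K)))).re)

/-! ### §1 The symmetric difference, restricted to the embeddings over one place -/

omit [IsCMField K] in
/-- The number of `φ ∈ Φ` with `φ(s) = φ₀(s)` and a property `p`, counted on the subtype `Φ` restricted to `φ(s) = φ₀(s)`,
is `|Φ ∩ {ψ : ψ(s) = φ₀(s) ∧ p ψ}|`. [folklore] -/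
theorem card_filter_filter_eq_ncard (s : K) (φ₀ : K →+* ℂ) (p : (K →+* ℂ) → Prop) :
    ((Finset.univ.filter fun φ : Φ.1 => φ.1 s = φ₀ s).filter fun φ : Φ.1 => p φ.1).card =
      (Φ.1 ∩ {ψ : K →+* ℂ | ψ s = φ₀ s ∧ p ψ}).ncard := by
  rw [Finset.filter_filter]
  convert card_filter_subtype_eq_ncard Φ (fun ψ => ψ s = φ₀ s ∧ p ψ) using 2
  ext φ
  simp only [Finset.mem_filter]

/-- **`#{φ ∈ Φ ∩ T : Im (ϖζ₀)^φ < 0} ≡ #{φ ∈ Φ ∩ T : Re ϖ^φ < 0} + #{φ ∈ Φ ∩ T : Im ζ₀^φ < 0} (mod 2)`** for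
`T = {ψ : ψ(s) = φ₀(s)}`, real `ϖ ≠ 0`, skew `ζ₀ ≠ 0` (part 55's `im_realMul_neg_iff` on `Φ ∩ T`).
research route conditional on HC_CM; not a corollary; Q11.4-sentence-2 already refuted in dim ≥ 3. [folklore] -/
theorem ncard_negSet_on_realMul_mod_two (s : K) (φ₀ : K →+* ℂ) {ϖ : K} (hϖ : IsCMField.complexConj K ϖ = ϖ)
    (hϖ0 : ϖ ≠ 0) (hζ₀ : IsCMField.complexConj K ζ₀ = -ζ₀) (h0 : ζ₀ ≠ 0) :
    (Φ.1 ∩ {ψ : K →+* ℂ | ψ s = φ₀ s ∧ (ψ (ϖ * ζ₀)).im < 0}).ncard % 2 =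
      ((Φ.1 ∩ {ψ : K →+* ℂ | ψ s = φ₀ s ∧ (ψ ϖ).re < 0}).ncard +
        (Φ.1 ∩ {ψ : K →+* ℂ | ψ s = φ₀ s ∧ (ψ ζ₀).im < 0}).ncard) % 2 := by
  rw [← card_filter_filter_eq_ncard Φ s φ₀ (fun ψ => (ψ (ϖ * ζ₀)).im < 0),
    ← card_filter_filter_eq_ncard Φ s φ₀ (fun ψ => (ψ ϖ).re < 0),
    ← card_filter_filter_eq_ncard Φ s φ₀ (fun ψ => (ψ ζ₀).im < 0)]
  have h := card_filter_not_iff_mod_two (Finset.univ.filter fun φ : Φ.1 => φ.1 s = φ₀ s)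
    (fun φ => (φ.1 ϖ).re < 0) (fun φ => (φ.1 ζ₀).im < 0)
  have hc : ((Finset.univ.filter fun φ : Φ.1 => φ.1 s = φ₀ s).filter fun φ : Φ.1 => (φ.1 (ϖ * ζ₀)).im < 0) =
      (Finset.univ.filter fun φ : Φ.1 => φ.1 s = φ₀ s).filter
        fun φ : Φ.1 => ¬ ((φ.1 ϖ).re < 0 ↔ (φ.1 ζ₀).im < 0) := by
    apply Finset.filter_congr
    intro φ _
    exact im_realMul_neg_iff hϖ hϖ0 hζ₀ h0 φ.1
  rw [hc]
  exact h

/-! ### §2 The sign of the relative norm at the place under `φ₀` -/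

/-- **`Re φ₀|_{K⁺}(N_{K⁺/ℚ(s)}(ϖ₀)) > 0 ⟺ #{φ ∈ Φ, φ(s) = φ₀(s) : Re ϖ^φ < 0}` is EVEN** (part 33's
`∏_{φ ∈ Φ, φ(s) = φ₀(s)} Re ϖ^φ = Re φ₀(N_{K⁺/ℚ(s)}(ϖ₀))`, and the sign of a product of non-zero reals).
research route conditional on HC_CM; not a corollary; Q11.4-sentence-2 already refuted in dim ≥ 3. [folklore] -/
theorem re_relNorm_pos_iff_even_ncard_on (s : maximalRealSubfield K) (φ₀ : K →+* ℂ)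
    {ϖ₀ : 𝓞 (maximalRealSubfield K)} (hϖ0 : ϖ₀ ≠ 0) :
    0 < RN[φ₀, s] ϖ₀ ↔
      Even ((Φ.1 ∩ {ψ : K →+* ℂ | ψ (s : K) = φ₀ (s : K) ∧ (ψ (𝓇 ϖ₀)).re < 0}).ncard) := by
  rw [← prod_filter_re_embedding_eq_re_norm Φ s ((ϖ₀ : maximalRealSubfield K)) φ₀,
    ← IsScalarTower.algebraMap_apply (𝓞 (maximalRealSubfield K)) (maximalRealSubfield K) K,
    prod_pos_iff_even_card_filter_neg _ _ (fun φ _ => re_embedding_ne_zero_of_real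
      (complexConj_algebraMap_ringOfIntegers ϖ₀) (algebraMap_ringOfIntegers_ne_zero hϖ0) φ.1),
    card_filter_filter_eq_ncard Φ (s : K) φ₀ (fun ψ => (ψ (𝓇 ϖ₀)).re < 0)]

/-! ### §3 The relative parity law (hypothesis-free) -/

/-- **`#{φ ∈ Φ, φ(s) = φ₀(s) : Im (ϖζ₀)^φ < 0}` is even ⟺ (`#{φ ∈ Φ, φ(s) = φ₀(s) : Im ζ₀^φ < 0}` is even ⟺
`Re φ₀(N_{K⁺/ℚ(s)}(ϖ₀)) > 0`)** — the twisted count over one place of `ℚ(s)` flips exactly when the relative norm of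
`ϖ₀` is negative at that place.  No hypothesis on units.
research route conditional on HC_CM; not a corollary; Q11.4-sentence-2 already refuted in dim ≥ 3. [folklore] -/
theorem even_ncard_negSet_on_realMul_iff (s : maximalRealSubfield K) (φ₀ : K →+* ℂ)
    {ϖ₀ : 𝓞 (maximalRealSubfield K)} (hϖ0 : ϖ₀ ≠ 0) (hζ₀ : IsCMField.complexConj K ζ₀ = -ζ₀) (h0 : ζ₀ ≠ 0) :
    Even ((Φ.1 ∩ {ψ : K →+* ℂ | ψ (s : K) = φ₀ (s : K) ∧ (ψ (𝓇 ϖ₀ * ζ₀)).im < 0}).ncard) ↔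
      (Even ((Φ.1 ∩ {ψ : K →+* ℂ | ψ (s : K) = φ₀ (s : K) ∧ (ψ ζ₀).im < 0}).ncard) ↔ 0 < RN[φ₀, s] ϖ₀) := by
  rw [re_relNorm_pos_iff_even_ncard_on Φ s φ₀ hϖ0, Nat.even_iff, Nat.even_iff, Nat.even_iff,
    ncard_negSet_on_realMul_mod_two Φ (s : K) φ₀ (complexConj_algebraMap_ringOfIntegers ϖ₀)
      (algebraMap_ringOfIntegers_ne_zero hϖ0) hζ₀ h0]
  omega

/-! ### §4 Under the relative THEOREM L (i): the two types never both occur when the relative norm is negative somewhere -/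

/-- **Occurring type ⇒ even `T`-count** (contrapositive of part 33's engine): under the relative THEOREM L (i)
(`hN`: `Re σ(N_{K⁺/ℚ(s)}(v)) > 0` for every unit `v` of `𝓞 K⁺` and every `σ`), if `ℂ^Φ/D(𝔪)` carries a `Φ`-positive
divisor of type `𝔣₀` then for every `φ₀` the count `#{φ ∈ Φ, φ(s) = φ₀(s) : Im ζ₀^φ < 0}` is even (`ζ₀` any skew
element of type `𝔣₀`).
research route conditional on HC_CM; not a corollary; Q11.4-sentence-2 already refuted in dim ≥ 3. [cite: Shimura1998, §14.3 Prop. 5, p. 104] -/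
theorem even_ncard_on_of_exists (hζ₀ : IsCMField.complexConj K ζ₀ = -ζ₀) (h0 : ζ₀ ≠ 0) (hT : IsOfType 𝔪 ζ₀ 𝔣₀)
    (s : maximalRealSubfield K)
    (hN : ∀ v : (𝓞 (maximalRealSubfield K))ˣ, ∀ σ : maximalRealSubfield K →+* ℂ,
      0 < (σ (algebraMap ℚ⟮s⟯ (maximalRealSubfield K)
        (Algebra.norm ℚ⟮s⟯ (((v : 𝓞 (maximalRealSubfield K)) : maximalRealSubfield K))))).re)
    (hex : ∃ ζ : K, IsCMField.complexConj K ζ = -ζ ∧ (∀ φ : Φ.1, 0 < (φ.1 ζ).im) ∧ IsOfType 𝔪 ζ 𝔣₀)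
    (φ₀ : K →+* ℂ) :
    Even ((Φ.1 ∩ {ψ : K →+* ℂ | ψ (s : K) = φ₀ (s : K) ∧ (ψ ζ₀).im < 0}).ncard) := by
  by_contra hodd
  exact not_exists_pos_isOfType_of_relNorm_pos_of_odd Φ 𝔪 hζ₀ h0 hT s hN φ₀ (Nat.not_even_iff_odd.mp hodd) hex

/-- **THE RELATIVE NORM-SIGN OBSTRUCTION.**  Under the relative THEOREM L (i) for `ℚ(s) ⊂ K⁺`: if the relative norm
`N_{K⁺/ℚ(s)}(ϖ₀)` is NEGATIVE at the place under some `φ₀`, then the types `𝔣₀` and `(ϖ₀)𝔣₀` do not BOTH occur on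
`ℂ^Φ/D(𝔪)` — the two counts over that place differ by an odd number, so one of them is odd.
research route conditional on HC_CM; not a corollary; Q11.4-sentence-2 already refuted in dim ≥ 3. [cite: Shimura1998, §14.3 Prop. 5, p. 104] -/
theorem not_and_of_re_relNorm_neg (hζ₀ : IsCMField.complexConj K ζ₀ = -ζ₀) (h0 : ζ₀ ≠ 0) (hT : IsOfType 𝔪 ζ₀ 𝔣₀)
    (s : maximalRealSubfield K) {ϖ₀ : 𝓞 (maximalRealSubfield K)} (φ₀ : K →+* ℂ) (hneg : RN[φ₀, s] ϖ₀ < 0)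
    (hN : ∀ v : (𝓞 (maximalRealSubfield K))ˣ, ∀ σ : maximalRealSubfield K →+* ℂ,
      0 < (σ (algebraMap ℚ⟮s⟯ (maximalRealSubfield K)
        (Algebra.norm ℚ⟮s⟯ (((v : 𝓞 (maximalRealSubfield K)) : maximalRealSubfield K))))).re) :
    ¬ ((∃ ζ : K, IsCMField.complexConj K ζ = -ζ ∧ (∀ φ : Φ.1, 0 < (φ.1 ζ).im) ∧ IsOfType 𝔪 ζ 𝔣₀) ∧
        (∃ ζ : K, IsCMField.complexConj K ζ = -ζ ∧ (∀ φ : Φ.1, 0 < (φ.1 ζ).im) ∧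
          IsOfType 𝔪 ζ (Ideal.span {ϖ₀} * 𝔣₀))) := by
  have hϖ0 : ϖ₀ ≠ 0 := by
    rintro rfl
    simp at hneg
  rintro ⟨h1, h2⟩
  have e1 := even_ncard_on_of_exists Φ 𝔪 hζ₀ h0 hT s hN h1 φ₀
  have e2 := even_ncard_on_of_exists Φ 𝔪 (complexConj_realMul ϖ₀ hζ₀)
    (mul_ne_zero (algebraMap_ringOfIntegers_ne_zero hϖ0) h0) (isOfType_realMul 𝔪 ϖ₀ hT) s hN h2 φ₀
  have h := (even_ncard_negSet_on_realMul_iff Φ s φ₀ hϖ0 hζ₀ h0).mp e2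
  exact (lt_asymm (h.mp e1)) hneg

/-- **If type `𝔣₀` occurs and `N_{K⁺/ℚ(s)}(ϖ₀)` is negative at some place, type `(ϖ₀)𝔣₀` does NOT occur** (relative
THEOREM L (i)).
research route conditional on HC_CM; not a corollary; Q11.4-sentence-2 already refuted in dim ≥ 3. [cite: Shimura1998, §14.3 Prop. 5, p. 104] -/
theorem not_exists_realMul_of_exists_of_re_relNorm_neg (hζ₀ : IsCMField.complexConj K ζ₀ = -ζ₀) (h0 : ζ₀ ≠ 0)
    (hT : IsOfType 𝔪 ζ₀ 𝔣₀) (s : maximalRealSubfield K) {ϖ₀ : 𝓞 (maximalRealSubfield K)} (φ₀ : K →+* ℂ)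
    (hneg : RN[φ₀, s] ϖ₀ < 0)
    (hN : ∀ v : (𝓞 (maximalRealSubfield K))ˣ, ∀ σ : maximalRealSubfield K →+* ℂ,
      0 < (σ (algebraMap ℚ⟮s⟯ (maximalRealSubfield K)
        (Algebra.norm ℚ⟮s⟯ (((v : 𝓞 (maximalRealSubfield K)) : maximalRealSubfield K))))).re)
    (hex : ∃ ζ : K, IsCMField.complexConj K ζ = -ζ ∧ (∀ φ : Φ.1, 0 < (φ.1 ζ).im) ∧ IsOfType 𝔪 ζ 𝔣₀) :
    ¬ ∃ ζ : K, IsCMField.complexConj K ζ = -ζ ∧ (∀ φ : Φ.1, 0 < (φ.1 ζ).im) ∧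
        IsOfType 𝔪 ζ (Ideal.span {ϖ₀} * 𝔣₀) :=
  fun h => not_and_of_re_relNorm_neg Φ 𝔪 hζ₀ h0 hT s φ₀ hneg hN ⟨hex, h⟩

/-- **The principal case**: with `ζ₀` of principal type (`IsOfType 𝔪 ζ₀ ⊤`), if `ℂ^Φ/D(𝔪)` is principally polarisable
(`ι`-compatibly) and `N_{K⁺/ℚ(s)}(ϖ₀)` is negative at some place, then it carries NO `Φ`-positive divisor of type `(ϖ₀)`
(relative THEOREM L (i)) — at `39/56`: the ramified and inert primes whose generators have a relative norm to
`ℚ(√13)` / `ℚ(√2)` negative at one place give no type on the principally polarised tori.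
research route conditional on HC_CM; not a corollary; Q11.4-sentence-2 already refuted in dim ≥ 3. [cite: Shimura1998, §14.3 Prop. 5, p. 104] -/
theorem not_exists_span_of_principal_of_re_relNorm_neg (hζ₀ : IsCMField.complexConj K ζ₀ = -ζ₀) (h0 : ζ₀ ≠ 0)
    (hT : IsOfType 𝔪 ζ₀ ⊤) (s : maximalRealSubfield K) {ϖ₀ : 𝓞 (maximalRealSubfield K)} (φ₀ : K →+* ℂ)
    (hneg : RN[φ₀, s] ϖ₀ < 0)
    (hN : ∀ v : (𝓞 (maximalRealSubfield K))ˣ, ∀ σ : maximalRealSubfield K →+* ℂ,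
      0 < (σ (algebraMap ℚ⟮s⟯ (maximalRealSubfield K)
        (Algebra.norm ℚ⟮s⟯ (((v : 𝓞 (maximalRealSubfield K)) : maximalRealSubfield K))))).re)
    (hpr : ∃ ζ : K, IsCMField.complexConj K ζ = -ζ ∧ (∀ φ : Φ.1, 0 < (φ.1 ζ).im) ∧ IsOfType 𝔪 ζ ⊤) :
    ¬ ∃ ζ : K, IsCMField.complexConj K ζ = -ζ ∧ (∀ φ : Φ.1, 0 < (φ.1 ζ).im) ∧
        IsOfType 𝔪 ζ (Ideal.span {ϖ₀}) := by
  have h := not_exists_realMul_of_exists_of_re_relNorm_neg Φ 𝔪 hζ₀ h0 hT s φ₀ hneg hN hpr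
  rwa [Ideal.mul_top] at h

/-! ### §5 The relative THEOREM L (i) at the census levels `39` (`s = √13`) and `56` (`s = √2`), packaged -/

/-- **The relative THEOREM L (i) at `39`, packaged**: for `s ∈ K⁺` with `s = 1 + 2(ζ³ + ζ⁹ + ζ¹² + ζ²⁷ + ζ³⁰ + ζ³⁶)`
(`= √13`, the Gauss sum of `η = ζ³`), every unit `v` of `𝓞 K⁺` has `Re σ(N_{K⁺/ℚ(s)}(v)) > 0` at every `σ` (part 34b
`re_embedding_relNorm_pos_thirteen` with `w = 2(1 + 2ζ¹³)(π₀ − π₂)`, `w² = 78 − 18s`).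
research route conditional on HC_CM; not a corollary; Q11.4-sentence-2 already refuted in dim ≥ 3. [folklore] -/
theorem relNorm_units_pos_thirtyNine {ζ : K} (hζ : IsPrimitiveRoot ζ 39) (s : maximalRealSubfield K)
    (hs : (s : K) = 1 + 2 * (ζ ^ 3 + ζ ^ 9 + ζ ^ 12 + ζ ^ 27 + ζ ^ 30 + ζ ^ 36))
    (v : (𝓞 (maximalRealSubfield K))ˣ) (σ : maximalRealSubfield K →+* ℂ) :
    0 < (σ (algebraMap ℚ⟮s⟯ (maximalRealSubfield K)
      (Algebra.norm ℚ⟮s⟯ (((v : 𝓞 (maximalRealSubfield K)) : maximalRealSubfield K))))).re := by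
  have hη : IsPrimitiveRoot (ζ ^ 3) 13 := hζ.pow (by norm_num) (by norm_num)
  have hω : IsPrimitiveRoot (ζ ^ 13) 3 := hζ.pow (by norm_num) (by norm_num)
  have hs' : (s : K) = 1 + 2 * (ζ ^ 3 + (ζ ^ 3) ^ 3 + (ζ ^ 3) ^ 4 + (ζ ^ 3) ^ 9 + (ζ ^ 3) ^ 10 + (ζ ^ 3) ^ 12) := by
    rw [hs]; ring
  set D : K := (ζ ^ 3 + (ζ ^ 3) ^ 3 + (ζ ^ 3) ^ 9) - ((ζ ^ 3) ^ 4 + (ζ ^ 3) ^ 12 + (ζ ^ 3) ^ 10) with hD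
  set w₀ : K := 2 * (1 + 2 * ζ ^ 13) * D with hw₀
  have hwreal : IsCMField.complexConj K w₀ = w₀ := by
    rw [hw₀, map_mul, map_mul, map_ofNat, complexConj_gaussThree hω, hD, complexConj_piDiff hη]; ring
  have hs2 : (s : K) ^ 2 = 13 := by rw [hs']; exact sq_gaussThirteen hη
  have hw2 : w₀ ^ 2 = 78 - 18 * (s : K) := by
    have A := sq_gaussThree hω
    have B := two_mul_sq_piDiff hη
    rw [hs', hw₀, hD]
    rw [← hD] at B ⊢
    linear_combination (4 * D ^ 2) * A - 6 * B
  set w : maximalRealSubfield K := ⟨w₀, (IsCMField.complexConj_eq_self_iff K w₀).mp hwreal⟩ with hw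
  have hs2' : s ^ 2 = 13 := by apply Subtype.ext; push_cast; exact hs2
  have hw2' : w ^ 2 = 78 - 18 * s := by apply Subtype.ext; push_cast; exact hw2
  exact re_embedding_relNorm_pos_thirteen hs2' hw2' v σ

/-- **The relative THEOREM L (i) at `56`, packaged**: for `s ∈ K⁺` with `s = ζ⁷ + ζ⁴⁹` (`= √2`, `μ + μ⁷` for
`μ = ζ⁷`), every unit `v` of `𝓞 K⁺` has `Re σ(N_{K⁺/ℚ(s)}(v)) > 0` at every `σ` (part 34b `re_embedding_relNorm_pos_two`
with `w = √7 = ν⁷(1 + 2(ν⁴ + ν⁸ + ν¹⁶))`, `ν = ζ²`).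
research route conditional on HC_CM; not a corollary; Q11.4-sentence-2 already refuted in dim ≥ 3. [folklore] -/
theorem relNorm_units_pos_fiftySix {ζ : K} (hζ : IsPrimitiveRoot ζ 56) (s : maximalRealSubfield K)
    (hs : (s : K) = ζ ^ 7 + ζ ^ 49) (v : (𝓞 (maximalRealSubfield K))ˣ) (σ : maximalRealSubfield K →+* ℂ) :
    0 < (σ (algebraMap ℚ⟮s⟯ (maximalRealSubfield K)
      (Algebra.norm ℚ⟮s⟯ (((v : 𝓞 (maximalRealSubfield K)) : maximalRealSubfield K))))).re := by
  have hμ : IsPrimitiveRoot (ζ ^ 7) 8 := hζ.pow (by norm_num) (by norm_num)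
  have hζ2 : IsPrimitiveRoot (ζ ^ 2) 28 := hζ.pow (by norm_num) (by norm_num)
  have hs' : (s : K) = ζ ^ 7 + (ζ ^ 7) ^ 7 := by rw [hs]; ring
  set w₀ : K := (ζ ^ 2) ^ 7 * (1 + 2 * ((ζ ^ 2) ^ 4 + (ζ ^ 2) ^ 8 + (ζ ^ 2) ^ 16)) with hw₀
  have hwreal : IsCMField.complexConj K w₀ = w₀ := complexConj_sqrtSeven hζ2
  have hs2 : (s : K) ^ 2 = 2 := by rw [hs']; exact sq_sqrtTwo hμ
  have hw2 : w₀ ^ 2 = 7 := sq_sqrtSeven hζ2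
  set w : maximalRealSubfield K := ⟨w₀, (IsCMField.complexConj_eq_self_iff K w₀).mp hwreal⟩ with hw
  have hs2' : s ^ 2 = 2 := by apply Subtype.ext; push_cast; exact hs2
  have hw2' : w ^ 2 = 7 := by apply Subtype.ext; push_cast; exact hw2
  exact re_embedding_relNorm_pos_two hs2' hw2' v σ

end Summit.HodgeConjecture.Ring2WeilCoverage.TypeRelativeNormSign

end
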